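import Literature.AnabelianGeometry.EtaleTheta.Discharge.Sec1Thm110ModelTateNV
import Literature.AnabelianGeometry.EtaleTheta.Discharge.Sec1DeckNegatesCoordModelChi
import Literature.AnabelianGeometry.EtaleTheta.SettingModelTateDeckDisplayNegOne
import Literature.AnabelianGeometry.EtaleTheta.Discharge.Sec2ThetaOrbitClasses
import Literature.AnabelianGeometry.EtaleTheta.ContH1Lemmas
import HarnessLib

/-!
# [EtTh] Def. 1.9 at the STAGE-2 («Tate shear») model: the deck element IS the `μ₂`-deck transformation

S. Mochizuki, *The étale theta function and its Frobenioid-theoretic manifestations*, Publ. RIMS **45** (2009)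
[EtTh], §1, Def. 1.9, PRIMS PDF p. 29: "`τ⁻¹` — the 4-torsion point determined by `−√−1`"; Prop. 1.5 (iii) p. 23:
"`log(Ü) ↦ log(Ü) + log(O^×_K̈)`" under `Π^tp_Y`. [cite: MochizukiEtTh2009, Def 1.9 p.29]

Layer L2 of the abc-iut cell, seat abc-iut-w5-d140 (gen 4), K2 holder (SUBDAG EtTh:Thm1.10), row «deck element =
μ₂-deck transformation @ STAGE 2». PROOF-ONLY (no definition, no instance, no `Prop` fact): the stage-2 twin of this
seat's `Sec1DeckNegatesCoordModelChi` (p447647) at abc-iut-w5-d171's Tate instance `MuTwoSetting.modelχq p 1 2` /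
section datum `kummerDataχqInr` / Def. 1.9 points `tauχq`, `tauInvχq` (p446740).

WHAT IS NEW. At stage 1 the negation law `ε·infl log(Ü) = infl log(Ü)·infl κ̈(−1)` was computed on cocycles; at stage 2
it is ASSEMBLED from the tree by the inner-action calculus: write the deck element `ε = b^t` (`t` ODD — this seat's
`exists_odd_deck_exponent`, the SAME exponent as at stage 1 since `κ_u` is stage-independent, abc-iut-w5-d171's
`kappaUnitχq_tate_eq`) as `ε = b^{t−1} · β` with `β = b¹` and `b^{t−1} ∈ Π^tp_Ÿ` (`t − 1 ∈ 2Ẑ`); then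
`ε·x = b^{t−1}·(β·x) = β·x` on `H¹(Π^tp_Ÿ, Δ_Θ)` (inner automorphisms act trivially, `ContH1.conj_eq_self_of_mem`),
`β·infl = infl ∘ (β·)` (`ContH1.infl_conj`), and `β·log(Ü) = log(Ü)·κ(−1)` is abc-iut-L2-t6's stage-2 display
`conj_beta_logUdd` (F7q part 2c). RESULTS: `inl_bPowGfp_mem_GtpYdd_modelχq` (`b^s ∈ Π^tp_Ÿ` for `s ∈ 2Ẑ`),
**`conj_inl_bPowGfp_inflTheta_logUdd_modelχq_of_odd`** (any `i`, even `j`, any odd `t`),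
**`exists_deck_negates_coord_modelχq`** (ONE `ε` at the Tate instance: `toZ ε = 1` ∧ `D_{τ⁻¹} = D_τ.comap (conj ε)` ∧
the negation law — every hypothesis discharged, `Compat` by abc-iut's `ThetaSetting.compat`) and
**`exists_anchoredStandardData_of_deck_modelχq`**: this lineage's `MuTwoSetting.exists_anchoredStandardData_of_deck`
(p431196) FIRES at the stage-2 record — the model where Prop. 1.5 (iii) also holds (abc-iut-L2-t6).

HONEST FRAMING: SEMI-SYNTHETIC model — consistency / non-vacuity evidence for the typed interface ONLY; nothing of
[EtTh] is asserted; typed ≠ proved; no side is taken on [IUTchIII] Cor. 3.12.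
-/

noncomputable section

namespace Literature.AnabelianGeometry.EtaleTheta.SettingModel

open Literature.AnabelianGeometry.SemiGraphs Literature.AnabelianGeometry.AbsoluteAnabelian
open _root_.Topology _root_.Function

variable (p : ℕ) [Fact p.Prime] (i j : ℤ)

/-! ### §1. `b^s ∈ Π^tp_Ÿ` for even `s`; the generator `β = b¹` has odd exponent -/

/-- **`inl(b^s) ∈ Π^tp_Ÿ` for `s ∈ 2Ẑ`** at `modelχq` (degree `0`, level-`2` `y`-coordinate `s ≡ 0`).
[cite: MochizukiEtTh2009, §1 p.17] -/
theorem inl_bPowGfp_mem_GtpYdd_modelχq (hj : Even j) {s : ZH} (hs : s ∈ sqHom.range) :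
    (SemidirectProduct.inl (bPowGfp s) : PiTpχq p i j) ∈ (ThetaSetting.modelχq p i j hj).GtpYdd :=
  mem_GtpYdd_modelχq_of_hHat_two_y p i j hj (inl_bPowGfp_mem_GtpY_modelχq p i j hj _) (by
    rw [SemidirectProduct.left_inl, hHat_y_eq_zero_iff, gfpFst_bPowGfp, eHatB_bPow]
    exact (mem_range_sqHom_iff _).mp hs)

/-- The generator `1 ∈ Ẑ` is odd (`level 2 (η 1) ≠ 1`). [folklore] -/
private theorem level_two_eta_one_ne_one : ZHatLevel.level 2 (ZHatLevel.eta 1) ≠ 1 := by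
  rw [ZHatLevel.level_eta, Int.cast_one]
  decide

/-- `b^t = b^{t·1⁻¹} · b¹` in `Π^tp_X`. [folklore] -/
private theorem inl_bPowGfp_eq_mul_beta (t : ZH) :
    (SemidirectProduct.inl (bPowGfp t) : PiTpχq p i j) =
      SemidirectProduct.inl (bPowGfp (t * (ZHatLevel.eta 1)⁻¹)) * SemidirectProduct.inl (bPowGfp (ZHatLevel.eta 1)) := by
  rw [← map_mul, ← map_mul, inv_mul_cancel_right]

/-! ### §2. `ε·infl log(Ü) = infl log(Ü)·infl κ(−1)` for every ODD `b`-power `ε = b^t` -/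

/-- **THE NEGATION LAW at the stage-2 model for any odd exponent** (any `i`, even `j`): for `t ∈ Ẑ` with
`level 2 t ≠ 1`, conjugation by `ε = inl(b^t)` on `H¹(Π^tp_Ÿ, Δ_Θ)` sends `infl log(Ü)` to `infl log(Ü) · infl κ(−1)`
(classes of the core datum). Assembly: `ε = b^{t−1}·β`, `b^{t−1} ∈ Π^tp_Ÿ` acts trivially, `infl` commutes with the
actions, and `β·log(Ü) = log(Ü)·κ(−1)` is abc-iut-L2-t6's `conj_beta_logUdd`. [cite: MochizukiEtTh2009, Prop 1.5 (iii) p.23] -/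
theorem conj_inl_bPowGfp_inflTheta_logUdd_modelχq_of_odd (hj : Even j) (hC : (ThetaSetting.modelχq p i j hj).Compat)
    {t : ZH} (ht : ZHatLevel.level 2 t ≠ 1) :
    haveI := hC.GtpYdd_normal
    ContH1.conj (ThetaSetting.modelχq p i j hj).toTheta (ThetaSetting.modelχq p i j hj).DeltaTheta
        (SemidirectProduct.inl (bPowGfp t) : PiTpχq p i j)
        ((ThetaSetting.modelχq p i j hj).inflTheta (ThetaSetting.modelχq p i j hj).GtpYdd
          (kummerCoreχq p i j hj).logUdd) =
      (ThetaSetting.modelχq p i j hj).inflTheta (ThetaSetting.modelχq p i j hj).GtpYdd (kummerCoreχq p i j hj).logUdd *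
        (ThetaSetting.modelχq p i j hj).inflTheta (ThetaSetting.modelχq p i j hj).GtpYdd
          ((kummerCoreχq p i j hj).toKummerData.kumYdd
            ((kummerCoreχq p i j hj).toKummerData.toKddHat (-1 : (↥(ThetaSetting.modelχq p i j hj).Kdd)ˣ))) := by
  haveI := hC.GtpYdd_normal
  haveI := hC.GtpYddTheta_normal
  have hmem : (SemidirectProduct.inl (bPowGfp (t * (ZHatLevel.eta 1)⁻¹)) : PiTpχq p i j) ∈
      (ThetaSetting.modelχq p i j hj).GtpYdd :=
    inl_bPowGfp_mem_GtpYdd_modelχq p i j hj (mul_inv_mem_range_sqHom_of_odd ht level_two_eta_one_ne_one)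
  -- `β·infl log(Ü) = infl (β·log(Ü)) = infl (log(Ü)·κ(−1))`
  have hβ : ContH1.conj (ThetaSetting.modelχq p i j hj).toTheta (ThetaSetting.modelχq p i j hj).DeltaTheta
        (SemidirectProduct.inl (bPowGfp (ZHatLevel.eta 1)) : PiTpχq p i j)
        ((ThetaSetting.modelχq p i j hj).inflTheta (ThetaSetting.modelχq p i j hj).GtpYdd
          (kummerCoreχq p i j hj).logUdd) =
      (ThetaSetting.modelχq p i j hj).inflTheta (ThetaSetting.modelχq p i j hj).GtpYdd
        ((kummerCoreχq p i j hj).logUdd *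
          (kummerCoreχq p i j hj).toKummerData.kumYdd
            ((kummerCoreχq p i j hj).toKummerData.toKddHat (-1 : (↥(ThetaSetting.modelχq p i j hj).Kdd)ˣ))) := by
    rw [← conj_beta_logUdd p i j hj hC]
    exact (ContH1.infl_conj (A := (ThetaSetting.modelχq p i j hj).DeltaTheta)
      (hψ := (ThetaSetting.modelχq p i j hj).continuous_toTheta) le_rfl _ _).symm
  rw [inl_bPowGfp_eq_mul_beta p i j t, ContH1.conj_mul_apply, hβ, ContH1.conj_eq_self_of_mem _ hmem, map_mul]

/-! ### §3. ONE deck element with BOTH properties at the Tate instance `modelχq p 1 2` -/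

/-- From the section identity to the decomposition groups (as in p442729 / p446740). [folklore] -/
private theorem map_eq_comap_conj_of_conj_eq_tate' {s s' : GQp p →* PiTpχq p 1 2} {ε : PiTpχq p 1 2}
    (h : ∀ σ : GQp p, ε * s' σ * ε⁻¹ = s σ) (G : Subgroup (GQp p)) :
    G.map s' = (G.map s).comap (MulAut.conj ε).toMonoidHom := by
  ext x
  rw [Subgroup.mem_comap, MulEquiv.coe_toMonoidHom, MulAut.conj_apply]
  constructor
  · rintro ⟨σ, hσ, rfl⟩
    exact ⟨σ, hσ, (h σ).symm⟩
  · rintro ⟨σ, hσ, hx⟩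
    refine ⟨σ, hσ, ?_⟩
    rw [← h σ] at hx
    exact mul_left_cancel (mul_right_cancel hx)

/-- **An ODD deck element at stage 2**: `ε = b^t` with `t` odd, `toZ ε = 1` and `ε·s_{(√−1)⁻¹}·ε⁻¹ = s_{√−1}` — the same
exponent as at stage 1 (`κ_u` is stage-independent). [cite: MochizukiEtTh2009, Def 1.9 p.29] -/
theorem exists_odd_deck_sectionOfUnitχq (hp : p % 4 = 1) :
    ∃ t : ZH, ZHatLevel.level 2 t ≠ 1 ∧
      (ThetaSetting.modelχq p 1 2 even_two).toZ (SemidirectProduct.inl (bPowGfp t) : PiTpχq p 1 2) = 1 ∧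
      ∀ σ : GQp p, (SemidirectProduct.inl (bPowGfp t) : PiTpχq p 1 2) *
          sectionOfUnitχq p 1 2 even_two (sqrtNegOneInvUnitχ p hp) σ * (SemidirectProduct.inl (bPowGfp t))⁻¹ =
        sectionOfUnitχq p 1 2 even_two (sqrtNegOneUnitχ p hp) σ := by
  obtain ⟨t, ht, hodd⟩ := exists_odd_deck_exponent p hp
  refine ⟨t, hodd, inl_bPowGfp_mem_GtpY_modelχq p 1 2 even_two t, fun σ => ?_⟩
  unfold sectionOfUnitχq
  refine SemidirectProduct.ext ?_ ?_
  · rw [inl_bPowGfp_conj_sectionχq_left, sectionχq_left, Pi.mul_apply, Pi.mul_apply, kappaUnitχq_tate_eq,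
      kappaUnitχq_tate_eq, ht σ]
  · rw [inl_bPowGfp_conj_sectionχq_right, sectionχq_right]

/-- **THE DECK ELEMENT OF THE STAGE-2 MODEL IS THE `μ₂`-DECK TRANSFORMATION** (`p ≡ 1 (mod 4)`): there is
`ε = b^t ∈ Π^tp_X` of `toZ`-degree `0` with `D_{τ⁻¹} = D_τ.comap (conj ε)` for abc-iut-w5-d171's Def. 1.9 points
`τ^{±1} = tauχq / tauInvχq` of the section datum `kummerDataχqInr` AND `ε · infl log(Ü) = infl log(Ü) · infl κ̈(−1)` —
it relates the two 4-torsion sections and NEGATES the coordinate; every hypothesis discharged (`Compat` is abc-iut's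
theorem `ThetaSetting.compat`). [cite: MochizukiEtTh2009, Def 1.9 p.29] -/
theorem exists_deck_negates_coord_modelχq (hp : p % 4 = 1) :
    haveI := (ThetaSetting.modelχq p 1 2 even_two).compat.GtpYdd_normal
    ∃ ε : PiTpχq p 1 2, (ThetaSetting.modelχq p 1 2 even_two).toZ ε = 1 ∧
      (tauInvχq p hp).Dpt = (tauχq p hp).Dpt.comap (MulAut.conj ε).toMonoidHom ∧
      ContH1.conj (ThetaSetting.modelχq p 1 2 even_two).toTheta (ThetaSetting.modelχq p 1 2 even_two).DeltaTheta ε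
          ((ThetaSetting.modelχq p 1 2 even_two).inflTheta (ThetaSetting.modelχq p 1 2 even_two).GtpYdd
            (kummerDataχqInr p).logUdd) =
        (ThetaSetting.modelχq p 1 2 even_two).inflTheta (ThetaSetting.modelχq p 1 2 even_two).GtpYdd
            (kummerDataχqInr p).logUdd *
          (ThetaSetting.modelχq p 1 2 even_two).inflTheta (ThetaSetting.modelχq p 1 2 even_two).GtpYdd
            ((kummerDataχqInr p).kumYdd ((kummerDataχqInr p).toKddHat (-1))) := by
  haveI := (ThetaSetting.modelχq p 1 2 even_two).compat.GtpYdd_normal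
  obtain ⟨t, hodd, hZ, hconj⟩ := exists_odd_deck_sectionOfUnitχq p hp
  refine ⟨SemidirectProduct.inl (bPowGfp t), hZ, map_eq_comap_conj_of_conj_eq_tate' p hconj _, ?_⟩
  have h := conj_inl_bPowGfp_inflTheta_logUdd_modelχq_of_odd p 1 2 even_two
    (ThetaSetting.modelχq p 1 2 even_two).compat hodd
  rw [← kumYdd_toKddHat_ofSection_modelχq p 1 2 even_two _ (continuous_inrχq p 1 2) (fun _ => rfl)
    (inr_map_GK_le_GtpY_tate p) (inr_map_GKdd_le_GtpYdd_tate p)] at h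
  exact h

/-- **This lineage's `exists_anchoredStandardData_of_deck` (p431196) FIRES at the stage-2 record with every hypothesis
discharged**: from the ONE anchored point `τ = tauχq`, the deck element `ε` above and Prop. 1.5 (ii) (abc-iut-w5-d171's
`prop15i_and_ii_kummerDataχqInr`), an `AnchoredStandardData` at `MuTwoSetting.modelχq p 1 2` with `A.tau = τ`,
`A.sqrtNegOne = √−1` and the deck relation — at the model where Prop. 1.5 (iii) ALSO holds (abc-iut-L2-t6), independently
of the direct construction `anchoredStandardDataχq`. [cite: MochizukiEtTh2009, Def 1.9 p.29] -/
theorem exists_anchoredStandardData_of_deck_modelχq (hp : p % 4 = 1) :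
    ∃ (A : (MuTwoSetting.modelχq p 1 2 even_two).AnchoredStandardData (kummerDataχqInr p)) (ε : PiTpχq p 1 2),
      A.tau = tauχq p hp ∧ A.sqrtNegOne = sqrtNegOneχ p hp ∧ (ThetaSetting.modelχq p 1 2 even_two).toZ ε = 1 ∧
        A.tauInv.Dpt = (tauχq p hp).Dpt.comap (MulAut.conj ε).toMonoidHom := by
  obtain ⟨ε, hε, -, hneg⟩ := exists_deck_negates_coord_modelχq p hp
  obtain ⟨A, h1, h2, h3⟩ := MuTwoSetting.exists_anchoredStandardData_of_deck (M := MuTwoSetting.modelχq p 1 2 even_two)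
    (ThetaSetting.modelχq p 1 2 even_two).compat (prop15i_and_ii_kummerDataχqInr p _).2 (sqrtNegOneχ p hp)
    (sqrtNegOneχ_mem_K p hp) (sqrtNegOneχ_sq p hp) (tauχq p hp) rfl ε hneg
  exact ⟨A, ε, h1, h2, hε, h3⟩

/-- **CENSUS HEADLINE (stage 2, deck semantics).** For `p ≡ 1 (mod 4)` there are a Def. 1.7 setting whose theta setting
is an [EtTh] origin AND a Tate origin, a Kummer datum, two anchored points `τ`, `τ⁻¹` with coordinates `√−1`, `(√−1)⁻¹`,
and ONE `ε ∈ Π^tp_X` of degree `0` which conjugates `D_τ` onto `D_{τ⁻¹}` AND acts on `infl log(Ü)` by `infl κ̈(−1)` —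
witness abc-iut-w5-d171's `MuTwoSetting.modelχq p 1 2`. [cite: MochizukiEtTh2009, Def 1.9 p.29] -/
theorem _root_.Literature.AnabelianGeometry.EtaleTheta.MuTwoSetting.exists_stage2_deck_negates_coord
    (hp : p % 4 = 1) :
    ∃ (M : MuTwoSetting p) (_ : M.toThetaSetting.IsEtThOrigin) (_ : M.toThetaSetting.IsTateOrigin)
      (E : M.toThetaSetting.KummerData) (τ τ' : ThetaSetting.AnchoredPoint E) (ε : M.PiTemp),
      ((τ.coord : M.Kdd) : PadicAlgCl p) ^ 2 = -1 ∧
      ((τ'.coord : M.Kdd) : PadicAlgCl p) = (((τ.coord : M.Kdd) : PadicAlgCl p))⁻¹ ∧ M.toZ ε = 1 ∧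
      τ'.Dpt = τ.Dpt.comap (MulAut.conj ε).toMonoidHom ∧
      (haveI := M.toThetaSetting.compat.GtpYdd_normal
       ContH1.conj M.toTheta M.toThetaSetting.DeltaTheta ε
          (M.toThetaSetting.inflTheta M.toThetaSetting.GtpYdd E.logUdd) =
        M.toThetaSetting.inflTheta M.toThetaSetting.GtpYdd E.logUdd *
          M.toThetaSetting.inflTheta M.toThetaSetting.GtpYdd (E.kumYdd (E.toKddHat (-1)))) := by
  obtain ⟨ε, hε, hD, hneg⟩ := exists_deck_negates_coord_modelχq p hp
  exact ⟨MuTwoSetting.modelχq p 1 2 even_two, ThetaSetting.modelχq_isEtThOrigin p 1 2 even_two,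
    modelχq_isTateOrigin p 1, kummerDataχqInr p, tauχq p hp, tauInvχq p hp, ε, sqrtNegOneχ_sq p hp, rfl, hε, hD, hneg⟩

end Literature.AnabelianGeometry.EtaleTheta.SettingModel

end
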